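import Literature.NumberTheory.EllipticCurves.KubertTateFiveMuDescentSqrtNegTwoMatrix
import Literature.NumberTheory.EllipticCurves.KubertTateM37152SqrtNegTwoValuations
import Literature.NumberTheory.EllipticCurves.KubertTateM37152ShaFive
import Literature.NumberTheory.EllipticCurves.KubertTateM37152EisensteinDescent
import Literature.NumberTheory.EllipticCurves.KubertTateFiveGaussianTwistRankZero
import Mathlib.Tactic.NormNum.Prime
import HarnessLib

/-!
# The `5`-descent of `E_{−37/152}` over `ℚ(√−2)` (one INERT place): rank `E(K) = 3`, `Ш(E ⊗ K)[5^∞] = 0`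
# (so the twist `E_{−37/152}^{(−8)}/ℚ` has RANK `1` and `t₅ = 0`: a rank-one door at a NON-anomalous prime, in the CGLS range)

PROOF-ONLY file (theorems only, no definition, no named fact, no `sorry`), topic `NumberTheory/EllipticCurves`; second instance of
the matrix form of the `5`-descent of the Kubert–Tate family over `ℚ(√−2)` (tree `KubertTateFiveMuDescentSqrtNegTwoMatrix`), at
`(m, n) = (−37, 152)`, over ANY number field `K` with `[K : ℚ] = 2`, `θ² = −2` (`SqrtNegTwo.FieldData θ`):

  `E = E_{−37/152} = [189, 5624, 854848, 0, 0]`, `Δ = −2¹⁵·19⁵·37⁵·40129`, `rank E(ℚ) = 2`, `t₅(E) = 0` (tree `KubertTateM37152ShaFive`);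
  `mn = −2³·19·37`: `19` SPLITS (`(1 + 3θ)(1 − 3θ)`), `37` is INERT, `2 = −θ²`; `ℚ(√−2)`-tame (`19 ∥ 6² + 2`, `40129 ∥ 4329² + 2`).

Over `K` the box has FOUR places `(θ), (1 + 3θ), (1 − 3θ), (37)` and is filled by the three `ℚ`-points `−T = (0, −854848)`,
`P₁ = (−830, 4700)`, `P₂ = (−2964, 64980)` and ONE `K`-point `R₁ = (−13376, 836608 + 586112θ)` (from the rational point `u = −13376`
of the twist `−2Y² = g(u)`): the `4 × 4` matrix of `log`-valuations of `f_T = xy − 152x² + 23104y` relative to `f_T(2T) = −1170286912`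
(valuation table `KubertTateM37152SqrtNegTwoDescent.log_valuation_points/base`),

  `M = [[3,3,3,2],[1,2,2,3],[4,4,4,3],[2,0,4,3]]` (mod `5`), left inverse `[[4,4,0,0],[3,3,4,1],[1,3,4,4],[1,0,3,0]]`.

* `shaCorank_five_eq_zero` — **`t₅(E_{−37/152} ⊗ K) = 0`**; `sha_torsionBy_five_eq_bot`; `mordellWeilRank_eq_three` — **`rank E(K) = 3`**;
  sequel `KubertTateM37152SqrtNegTwoTwist`: `rank E_{−37/152}^{(−8)}(ℚ) = 1`, `t₅ = 0`, `a₅ = −1` — a RANK-ONE door WITHOUT rational `5`-torsion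
  at a NON-anomalous good ordinary prime: the printed Eisenstein `5`-converse (Castella–Grossi–Lee–Skinner, Thm. E, `r = 1`) applies,
  so T is DISCHARGEABLE there modulo CGLS + GZK (Summits reading).  Nothing here proves T or BSD.

## References

* [SilvermanAEC2009] J. H. Silverman, *AEC*, 2nd ed., Thm. X.4.2, Prop. X.4.9, Exercise 10.1(c), Exercise 10.16, VII.3.1(b).
* [Fisher2001FiveSevenDescent] T. Fisher, JEMS 3 (2001), §§1–2.
* [IrelandRosen1990] K. Ireland, M. Rosen, *A Classical Introduction to Modern Number Theory*, 2nd ed., Ch. 13 §1.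
-/

noncomputable section

open scoped Classical NNReal NumberField AddSubgroup
open WeierstrassCurve WeierstrassCurve.Isogeny Field IsDedekindDomain Ideal
open Literature.NumberTheory.EllipticCurves Literature.NumberTheory.EllipticCurves.KubertTateVelu
  Literature.NumberTheory.EllipticCurves.KubertTateMuDescentNF Literature.NumberTheory.NumberFields
  Literature.NumberTheory.QuadraticFields

namespace Literature.NumberTheory.EllipticCurves

namespace KubertTateM37152SqrtNegTwoDescent

variable {K : Type} [Field K] [NumberField K] {θ : K}

/-! ## §1 The curve: `ℚ(√−2)`-tameness, the points over `K` -/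

/-- **`ℚ(√−2)`-TAME**: every bad prime `ℓ ∈ {2, 19, 37, 40129}` has `ℓ ≢ 1 (mod 5)`, and the two with `ℓ ≡ 4 (mod 5)` split in `ℤ[√−2]`:
`19 ∥ 6² + 2 = 2·19`, `40129 ∥ 4329² + 2 = 467·40129`. [cite: Fisher2001FiveSevenDescent, §2] [cite: IrelandRosen1990, Ch. 13 §1] -/
theorem sqrtNegTwo_tame : ∀ p : ℕ, p.Prime → (p : ℤ) ∣ (kubertTateFive (-37 : ℤ) 152).Δ →
    p % 5 ≠ 1 ∧ (p % 5 = 4 → ∃ x : ℤ, (p : ℤ) ∣ x ^ 2 + 2 ∧ ¬ (p : ℤ) ^ 2 ∣ x ^ 2 + 2) := by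
  intro p hp hdvd
  refine ⟨KubertTateM37152Descent.tame p hp hdvd, fun h4 ↦ ?_⟩
  rw [KubertTateM37152Descent.Δ_int] at hdvd
  have hdvdN : p ∣ 2 ^ 15 * 19 ^ 5 * 37 ^ 5 * 40129 := by
    have h' : (p : ℤ) ∣ ((2 ^ 15 * 19 ^ 5 * 37 ^ 5 * 40129 : ℕ) : ℤ) := by
      have e : ((2 ^ 15 * 19 ^ 5 * 37 ^ 5 * 40129 : ℕ) : ℤ) = 225779703027565292650496 := by norm_num
      rw [e]; exact (Int.dvd_neg.mpr hdvd)
    exact Int.natCast_dvd_natCast.mp h'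
  have hpi := Nat.Prime.prime hp
  rcases hpi.dvd_or_dvd hdvdN with h | h
  · rcases hpi.dvd_or_dvd h with h | h
    · rcases hpi.dvd_or_dvd h with h | h
      · have := (Nat.prime_dvd_prime_iff_eq hp Nat.prime_two).mp (hpi.dvd_of_dvd_pow h); omega
      · have := (Nat.prime_dvd_prime_iff_eq hp (by norm_num : Nat.Prime 19)).mp (hpi.dvd_of_dvd_pow h)
        subst this
        exact ⟨6, by norm_num, by norm_num⟩
    · have := (Nat.prime_dvd_prime_iff_eq hp (by norm_num : Nat.Prime 37)).mp (hpi.dvd_of_dvd_pow h); omega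
  · have := (Nat.prime_dvd_prime_iff_eq hp (by norm_num : Nat.Prime 40129)).mp h
    subst this
    exact ⟨4329, by norm_num, by norm_num⟩

/-- `E_{−37/152} ⊗ K` is elliptic. [cite: Kubert1976, Table 3 (N = 5)] -/
theorem isElliptic : (kubertTateFive ((-37 : ℤ) : K) ((152 : ℤ) : K)).IsElliptic :=
  haveI := KubertTateM37152Descent.isElliptic
  KubertTateGaussianTwist.isElliptic_base (K := K) (-37) 152

/-- The three `ℚ`-points `−T = (0, −854848)`, `P₁ = (−830, 4700)`, `P₂ = (−2964, 64980)`, the `K`-point `R₁ = (−13376, 836608 + 586112θ)`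
and the base point `2T = (−5624, 208088)` lie on `E_{−37/152} ⊗ K` (`θ² = −2`). [cite: Fisher2001FiveSevenDescent, §2 (the family; these points verified in-file)] -/
theorem nonsingular_points (hK : SqrtNegTwo.FieldData θ) :
    (kubertTateFive ((-37 : ℤ) : K) ((152 : ℤ) : K)).toAffine.Nonsingular 0 (-854848) ∧
    (kubertTateFive ((-37 : ℤ) : K) ((152 : ℤ) : K)).toAffine.Nonsingular (-830) 4700 ∧
    (kubertTateFive ((-37 : ℤ) : K) ((152 : ℤ) : K)).toAffine.Nonsingular (-2964) 64980 ∧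
    (kubertTateFive ((-37 : ℤ) : K) ((152 : ℤ) : K)).toAffine.Nonsingular (-13376 : K) ((836608 : K) + 586112 * θ) ∧
    (kubertTateFive ((-37 : ℤ) : K) ((152 : ℤ) : K)).toAffine.Nonsingular (-5624) 208088 := by
  haveI := isElliptic (K := K)
  have hsq := hK.sq_eq
  refine ⟨?_, ?_, ?_, ?_, ?_⟩ <;>
    rw [← Affine.equation_iff_nonsingular, KubertTateMuDescentNF.equation_iff_base (K := K) (-37) 152] <;> push_cast
  · norm_num
  · norm_num
  · norm_num
  · linear_combination ((586112 : K) ^ 2) * hsq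
  · norm_num

/-! ## §2 Distinctness of places -/

omit [NumberField K] in
/-- Places above different rational primes are different. [cite: IrelandRosen1990, Ch. 13 §1] -/
private theorem ne_of_natCast_mem {v w : HeightOneSpectrum (𝓞 K)} {ℓ ℓ' : ℕ} (hℓ : ℓ.Prime) (hℓ' : ℓ'.Prime)
    (hne : ℓ ≠ ℓ') (h : (ℓ : 𝓞 K) ∈ v.asIdeal) (h' : (ℓ' : 𝓞 K) ∈ w.asIdeal) : v ≠ w := by
  rintro rfl
  have hd := natCast_dvd_of_intCast_mem hℓ h (d := ℓ') (by rw [Int.cast_natCast]; exact h')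
  exact hne ((Nat.prime_dvd_prime_iff_eq hℓ hℓ').mp (Int.natCast_dvd_natCast.mp hd))

/-- Conjugate places above a split prime are different (`π + π̄ = s ∈ ℤ`, `ℓ ∈ v`, `a s + b ℓ = 1`). [cite: IrelandRosen1990, Ch. 13 §1] -/
private theorem ne_of_sum_mem (hK : SqrtNegTwo.FieldData θ) {v w : HeightOneSpectrum (𝓞 K)} {z z' : ℤ√(-2)} {s a b : ℤ} {ℓ : ℕ}
    (hzz : z + z' = (s : ℤ√(-2))) (hab : a * s + b * ℓ = 1)
    (hv : v.asIdeal = span {hK.ringEquiv z}) (hw : w.asIdeal = span {hK.ringEquiv z'}) (hℓ : (ℓ : 𝓞 K) ∈ v.asIdeal) : v ≠ w := by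
  rintro rfl
  have hz : hK.ringEquiv z ∈ v.asIdeal := by rw [hv]; exact mem_span_singleton_self _
  have hz' : hK.ringEquiv z' ∈ v.asIdeal := by rw [hw]; exact mem_span_singleton_self _
  have hs : (s : 𝓞 K) ∈ v.asIdeal := by
    rw [← hK.ringEquiv_intCast, ← hzz, map_add]
    exact v.asIdeal.add_mem hz hz'
  apply v.isPrime.ne_top
  rw [Ideal.eq_top_iff_one]
  have e : (1 : 𝓞 K) = (a : 𝓞 K) * s + (b : 𝓞 K) * ℓ := by exact_mod_cast congrArg (fun t : ℤ ↦ (t : 𝓞 K)) hab.symm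
  rw [e]
  exact v.asIdeal.add_mem (v.asIdeal.mul_mem_left _ hs) (v.asIdeal.mul_mem_left _ hℓ)

/-! ## §3 The descent over `K = ℚ(√−2)`: box full at four places -/

/-- **The complete `5`-descent of `E_{−37/152}` over `K = ℚ(√−2)`**: `t₅(E ⊗ K) = 0`, `Ш(E ⊗ K)[5] = 0` and `rank E(K) + 1 = 4`.
[cite: SilvermanAEC2009, Thm. X.4.2(a) and Thm. X.1.1] [cite: Fisher2001FiveSevenDescent, §2] -/
theorem descent (hK : SqrtNegTwo.FieldData θ) :
    haveI := isElliptic (K := K)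
    (kubertTateFive ((-37 : ℤ) : K) ((152 : ℤ) : K)).shaCorank 5 = 0 ∧
      (kubertTateFive ((-37 : ℤ) : K) ((152 : ℤ) : K)).sha[((5 : ℕ) : ℤ)] = ⊥ ∧
      (kubertTateFive ((-37 : ℤ) : K) ((152 : ℤ) : K)).mordellWeilRank + 1 = 4 := by
  haveI := isElliptic (K := K)
  haveI := KubertTateM37152Descent.isElliptic
  haveI : Fact (Nat.Prime 3) := ⟨Nat.prime_three⟩
  obtain ⟨v₀, v₁, v₂, v₃, hv₀, hv₁, hv₂, hv₃⟩ := exists_places hK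
  obtain ⟨hℓ₀, hℓ₁, hℓ₂, hℓ₃⟩ := natCast_mem_places hK hv₀ hv₁ hv₂ hv₃
  obtain ⟨p₀, p₁, p₂, p₃⟩ := prime_gens hK
  have hπ₀ : hK.ringEquiv ⟨0, 1⟩ ∈ v₀.asIdeal := by rw [hv₀]; exact mem_span_singleton_self _
  have hπ₁ : hK.ringEquiv ⟨1, 3⟩ ∈ v₁.asIdeal := by rw [hv₁]; exact mem_span_singleton_self _
  have hπ₂ : hK.ringEquiv ⟨1, -3⟩ ∈ v₂.asIdeal := by rw [hv₂]; exact mem_span_singleton_self _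
  -- distinctness of the four places
  have h01 : v₀ ≠ v₁ := ne_of_natCast_mem Nat.prime_two (by norm_num) (by norm_num) hℓ₀ hℓ₁
  have h02 : v₀ ≠ v₂ := ne_of_natCast_mem Nat.prime_two (by norm_num) (by norm_num) hℓ₀ hℓ₂
  have h03 : v₀ ≠ v₃ := ne_of_natCast_mem Nat.prime_two (by norm_num) (by norm_num) hℓ₀ hℓ₃
  have h13 : v₁ ≠ v₃ := ne_of_natCast_mem (by norm_num) (by norm_num) (by norm_num) hℓ₁ hℓ₃
  have h23 : v₂ ≠ v₃ := ne_of_natCast_mem (by norm_num) (by norm_num) (by norm_num) hℓ₂ hℓ₃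
  have h12 : v₁ ≠ v₂ := ne_of_sum_mem hK (z := ⟨1, 3⟩) (z' := ⟨1, -3⟩) (s := 2) (a := -9) (b := 1) (ℓ := 19)
    (by decide) (by norm_num) hv₁ hv₂ hℓ₁
  have hpl : Function.Injective ![v₀, v₁, v₂, v₃] := by
    intro i j h
    fin_cases i <;> fin_cases j
    · rfl
    · exact absurd h h01
    · exact absurd h h02
    · exact absurd h h03
    · exact absurd h h01.symm
    · rfl
    · exact absurd h h12
    · exact absurd h h13
    · exact absurd h h02.symm
    · exact absurd h h12.symm
    · rfl
    · exact absurd h h23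
    · exact absurd h h03.symm
    · exact absurd h h13.symm
    · exact absurd h h23.symm
    · rfl
  -- the support: off the four places, `−37` and `152 = 2³·19` are units
  have hS : ∀ v : HeightOneSpectrum (𝓞 K), (∀ j, ![v₀, v₁, v₂, v₃] j ≠ v) →
      (((-37 : ℤ) : ℤ) : 𝓞 K) ∉ v.asIdeal ∧ (((152 : ℤ) : ℤ) : 𝓞 K) ∉ v.asIdeal := by
    intro v hv
    have n0 : v₀ ≠ v := hv 0
    have n1 : v₁ ≠ v := hv 1
    have n2 : v₂ ≠ v := hv 2
    have n3 : v₃ ≠ v := hv 3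
    have hP := v.isPrime
    constructor
    · intro h37mem
      have h' : ((37 : ℕ) : 𝓞 K) ∈ v.asIdeal := by
        have e : ((37 : ℕ) : 𝓞 K) = -(((-37 : ℤ) : ℤ) : 𝓞 K) := by push_cast; ring
        rw [e]; exact v.asIdeal.neg_mem h37mem
      exact n3 (eq_of_mem_of_mem_of_prime p₃ (by rw [hv₃]; exact mem_span_singleton_self _) h')
    · intro h152mem
      have e : (((152 : ℤ) : ℤ) : 𝓞 K) = (2 : 𝓞 K) ^ 3 * ((19 : ℕ) : 𝓞 K) := by norm_num
      rw [e] at h152mem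
      rcases hP.mem_or_mem h152mem with h | h
      · have h2 : (2 : 𝓞 K) ∈ v.asIdeal := hP.mem_of_pow_mem 3 h
        have e2 : (2 : 𝓞 K) = hK.ringEquiv ⟨0, 1⟩ * hK.ringEquiv ⟨0, -1⟩ := by
          rw [← map_mul, show (2 : 𝓞 K) = ((2 : ℤ) : 𝓞 K) by norm_num, ← hK.ringEquiv_intCast]
          exact congrArg hK.ringEquiv (by decide)
        rw [e2] at h2
        rcases hP.mem_or_mem h2 with h' | h'
        · exact n0 (eq_of_mem_of_mem_of_prime p₀ hπ₀ h')
        · have h'' : hK.ringEquiv ⟨0, 1⟩ ∈ v.asIdeal := by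
            have e' : hK.ringEquiv ⟨0, 1⟩ = -hK.ringEquiv ⟨0, -1⟩ := by
              rw [← map_neg]; exact congrArg hK.ringEquiv (by decide)
            rw [e']; exact v.asIdeal.neg_mem h'
          exact n0 (eq_of_mem_of_mem_of_prime p₀ hπ₀ h'')
      · have e19 : ((19 : ℕ) : 𝓞 K) = hK.ringEquiv ⟨1, 3⟩ * hK.ringEquiv ⟨1, -3⟩ := by
          rw [← map_mul, show ((19 : ℕ) : 𝓞 K) = ((19 : ℤ) : 𝓞 K) by norm_cast, ← hK.ringEquiv_intCast]
          exact congrArg hK.ringEquiv (by decide)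
        rw [e19] at h
        rcases hP.mem_or_mem h with h' | h'
        · exact n1 (eq_of_mem_of_mem_of_prime p₁ hπ₁ h')
        · exact n2 (eq_of_mem_of_mem_of_prime p₂ hπ₂ h')
  -- the points
  obtain ⟨hn0, hn1, hn2, hn3, hnb⟩ := nonsingular_points hK
  have hxy : ∀ i : Fin 4, ¬ (![(0 : K), -830, -2964, -13376] i = 0 ∧ ![(-854848 : K), 4700, 64980, (836608 : K) + 586112 * θ] i = 0) := by
    intro i
    fin_cases i
    · simp only [Fin.zero_eta, Matrix.cons_val_zero]; norm_num
    · simp only [Fin.mk_one, Matrix.cons_val_one, Matrix.cons_val_zero]; norm_num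
    · simp only [Fin.reduceFinMk, Matrix.cons_val]; norm_num
    · simp only [Fin.reduceFinMk, Matrix.cons_val]; norm_num
  have hf : ∀ i : Fin 4, ((![(0 : K), -830, -2964, -13376] i) * (![(-854848 : K), 4700, 64980, (836608 : K) + 586112 * θ] i) -
            ((152 : ℤ) : K) * (![(0 : K), -830, -2964, -13376] i) ^ 2 +
            ((152 : ℤ) : K) ^ 2 * (![(-854848 : K), 4700, 64980, (836608 : K) + 586112 * θ] i)) =
      (((![(hK.ringEquiv ⟨-19750408192, 0⟩ : 𝓞 K), (hK.ringEquiv ⟨-25000, 0⟩ : 𝓞 K), (hK.ringEquiv ⟨-26667792, 0⟩ : 𝓞 K), (hK.ringEquiv ⟨-19056918528, 5701697536⟩ : 𝓞 K)] i : 𝓞 K) : K)) := by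
    intro i
    fin_cases i
    · simp only [Fin.zero_eta, Matrix.cons_val_zero, hK.coe_ringEquiv]
      push_cast; ring
    · simp only [Fin.mk_one, Matrix.cons_val_one, Matrix.cons_val_zero, hK.coe_ringEquiv]
      push_cast; ring
    · simp only [Fin.reduceFinMk, Matrix.cons_val, hK.coe_ringEquiv]
      push_cast; ring
    · simp only [Fin.reduceFinMk, Matrix.cons_val, hK.coe_ringEquiv]
      push_cast; ring
  have hfb : ((-5624 : K) * 208088 - ((152 : ℤ) : K) * (-5624) ^ 2 + ((152 : ℤ) : K) ^ 2 * 208088) =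
      (((hK.ringEquiv ⟨-1170286912, 0⟩ : 𝓞 K) : 𝓞 K) : K) := by
    rw [hK.coe_ringEquiv]; push_cast; ring
  have hmat : Matrix.of (fun i j : Fin 4 ↦
      ((WithZero.log ((![v₀, v₁, v₂, v₃] j).valuation K
          ((![(0 : K), -830, -2964, -13376] i) * (![(-854848 : K), 4700, 64980, (836608 : K) + 586112 * θ] i) -
            ((152 : ℤ) : K) * (![(0 : K), -830, -2964, -13376] i) ^ 2 +
            ((152 : ℤ) : K) ^ 2 * (![(-854848 : K), 4700, 64980, (836608 : K) + 586112 * θ] i))) -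
        WithZero.log ((![v₀, v₁, v₂, v₃] j).valuation K
          ((-5624 : K) * 208088 - ((152 : ℤ) : K) * (-5624) ^ 2 + ((152 : ℤ) : K) ^ 2 * 208088)) : ℤ) : ZMod 5)) =
      !![3, 3, 3, 2; 1, 2, 2, 3; 4, 4, 4, 3; 2, 0, 4, 3] := by
    ext i j
    simp only [Matrix.of_apply]
    rw [hf i, hfb, log_valuation_points hK hv₀ hv₁ hv₂ hv₃ i j, log_valuation_base hK hv₀ hv₁ hv₂ hv₃ j]
    fin_cases i <;> fin_cases j <;> decide
  have hinv : (!![4, 4, 0, 0; 3, 3, 4, 1; 1, 3, 4, 4; 1, 0, 3, 0] : Matrix (Fin 4) (Fin 4) (ZMod 5)) *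
      !![3, 3, 3, 2; 1, 2, 2, 3; 4, 4, 4, 3; 2, 0, 4, 3] = 1 := by decide
  have hM : ∀ e : Fin 4 → ZMod 5, ∃ c : Fin 4 → ZMod 5, Matrix.vecMul c (Matrix.of (fun i j : Fin 4 ↦
      ((WithZero.log ((![v₀, v₁, v₂, v₃] j).valuation K
          ((![(0 : K), -830, -2964, -13376] i) * (![(-854848 : K), 4700, 64980, (836608 : K) + 586112 * θ] i) -
            ((152 : ℤ) : K) * (![(0 : K), -830, -2964, -13376] i) ^ 2 +
            ((152 : ℤ) : K) ^ 2 * (![(-854848 : K), 4700, 64980, (836608 : K) + 586112 * θ] i))) -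
        WithZero.log ((![v₀, v₁, v₂, v₃] j).valuation K
          ((-5624 : K) * 208088 - ((152 : ℤ) : K) * (-5624) ^ 2 + ((152 : ℤ) : K) ^ 2 * 208088)) : ℤ) : ZMod 5))) = e := by
    intro e
    refine ⟨Matrix.vecMul e !![4, 4, 0, 0; 3, 3, 4, 1; 1, 3, 4, 4; 1, 0, 3, 0], ?_⟩
    rw [hmat, Matrix.vecMul_vecMul, hinv, Matrix.vecMul_one]
  have h25 := KubertTateGaussianTwist.twentyfive_zsmul_toGeomPoints_cast_ne_zero (K := K) (-37) 152 KubertTateM37152EisensteinDescent.nonsingular_P₁_rat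
    (by norm_num) (by norm_num) 3 (by norm_num) (by norm_num) KubertTateM37152Descent.not_tor_dvd_Δ
  refine ⟨?_, ?_, ?_⟩
  · exact KubertTateMuDescentNF.shaCorank_five_eq_zero_of_matrix_sqrtNegTwo (-37) 152 _ (fun σ ↦ smul_toGeomPoints _ σ _) h25 hK
      KubertTateM37152Descent.not_five_dvd_Δ sqrtNegTwo_tame ![v₀, v₁, v₂, v₃] hpl hS
      ![(0 : K), -830, -2964, -13376]
      ![(-854848 : K), 4700, 64980, (836608 : K) + 586112 * θ]
      (fun i ↦ by fin_cases i <;> assumption) hxy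
      (-5624) 208088 hnb (by norm_num) hM
  · exact KubertTateMuDescentNF.sha_torsionBy_five_eq_bot_of_matrix_sqrtNegTwo (-37) 152 _ (fun σ ↦ smul_toGeomPoints _ σ _) h25 hK
      KubertTateM37152Descent.not_five_dvd_Δ sqrtNegTwo_tame ![v₀, v₁, v₂, v₃] hpl hS
      ![(0 : K), -830, -2964, -13376]
      ![(-854848 : K), 4700, 64980, (836608 : K) + 586112 * θ]
      (fun i ↦ by fin_cases i <;> assumption) hxy
      (-5624) 208088 hnb (by norm_num) hM
  · exact KubertTateMuDescentNF.mordellWeilRank_succ_eq_of_matrix_sqrtNegTwo (-37) 152 _ (fun σ ↦ smul_toGeomPoints _ σ _) h25 hK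
      KubertTateM37152Descent.not_five_dvd_Δ sqrtNegTwo_tame ![v₀, v₁, v₂, v₃] hpl hS
      ![(0 : K), -830, -2964, -13376]
      ![(-854848 : K), 4700, 64980, (836608 : K) + 586112 * θ]
      (fun i ↦ by fin_cases i <;> assumption) hxy
      (-5624) 208088 hnb (by norm_num) hM

/-! ## §4 The theorems -/

/-- **`t₅(E_{−37/152} ⊗ ℚ(√−2)) = 0`, UNCONDITIONALLY** (complete `5`-descent at four places, one inert). [cite: SilvermanAEC2009, Thm. X.4.2(a)]
[cite: Fisher2001FiveSevenDescent, §2] -/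
theorem shaCorank_five_eq_zero (hK : SqrtNegTwo.FieldData θ) :
    haveI := isElliptic (K := K)
    (kubertTateFive ((-37 : ℤ) : K) ((152 : ℤ) : K)).shaCorank 5 = 0 := (descent hK).1

/-- **`Ш(E_{−37/152}/ℚ(√−2))[5] = 0`, unconditionally.** [cite: SilvermanAEC2009, Thm. X.4.2(a)] -/
theorem sha_torsionBy_five_eq_bot (hK : SqrtNegTwo.FieldData θ) :
    haveI := isElliptic (K := K)
    (kubertTateFive ((-37 : ℤ) : K) ((152 : ℤ) : K)).sha[((5 : ℕ) : ℤ)] = ⊥ := (descent hK).2.1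

/-- **`rank E_{−37/152}(ℚ(√−2)) = 3`, unconditionally.** [cite: SilvermanAEC2009, Thm. X.4.2 and Thm. X.1.1] -/
theorem mordellWeilRank_eq_three (hK : SqrtNegTwo.FieldData θ) :
    haveI := isElliptic (K := K)
    (kubertTateFive ((-37 : ℤ) : K) ((152 : ℤ) : K)).mordellWeilRank = 3 := by
  have h := (descent hK).2.2
  omega

end KubertTateM37152SqrtNegTwoDescent

end Literature.NumberTheory.EllipticCurves

end
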